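import Summits.ABC.ABC.Theorems.FeketeScalesTargetOmegaSplit

/-!
# Crux stmt-ABC-2159 (`Summit.ABC.ABC.Theses.FeketeScales.Target`) — line `SketchIdeator2` (ω-split), SKELETON

Lead prover's registered skeleton (prover-line-stmt-ABC-2159-0), reshaped from the crux-ideation sketch
`Cruxes/Target/SketchIdeator2.lean` (idea `polyconstant-omega-split`; same cut as card `omega-graded-slack`).

    Target_of : Target := (tree glue) stub_bakerRefinement stub_ultraCompositeTail      (glue: PROVED in the tree,
      `Summit.ABC.ABC.Theorems.Target.target_of_bakerShape_of_tail`, file Theorems/FeketeScalesTargetOmegaSplit.lean)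

Stubs (the ONLY sorries; both conjecture-grade — each, with the other, implies `ABC`):
* `stub_bakerRefinement`  — Baker's refinement of abc with SOME constant, `∃ κ, c < κ N (log N)^ω/ω!` for all abc
  triples with `a < b`; LITERALLY the body of route LogCardinality's open crux item `BakerRefinement` (stmt-ABC-1756).
* `stub_ultraCompositeTail` — sub-power excess on the many-primes tail: for some `0 < θ' < θ < 1` and `A`, every
  abc triple with `ω(abc) > (log rad)^{θ'}` has `c < rad · exp(A (log rad)^θ)`; the weakest form the glue accepts
  (the few-primes regime is covered by `stub_bakerRefinement` for EVERY `θ'`). New; no engine known; no known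
  lower family threatens it for `θ' ≥ 1/2` (Stewart–Tijdeman/van Frankenhuysen/Bright families have
  `ω ≍ √L/log L`, excess `O(√L/log log L)`).
Calibration (tree): `Target.target_of_rstConjectureAUpper : RSTConjectureAUpper → Target`; floor: no sub-power
slack with exponent `< 1/2` (Stewart–Tijdeman, `EpsilonCannotBeDropped_holds`).
-/

set_option linter.dupNamespace false

namespace Summit.ABC.ABC.Cruxes.Target.SketchIdeator2

/-- STUB (small ω / few primes): Baker's refinement of abc with some constant — `∃ κ, c < κ·N·(log N)^ω/ω!`
for every abc triple with `a < b` (`N = rad(abc)`, `ω = ω(abc)`).  Verbatim the body of item stmt-ABC-1756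
(`Summit.ABC.ABC.Theses.LogCardinality.BakerRefinement`).  Conjecture-grade (Baker 1998/2004). -/
theorem stub_bakerRefinement : ∃ κ : ℝ, Literature.Barriers.ABC.BakerShapeExplicitABC κ := by
  sorry

/-- STUB (large ω / ultra-composite tail): for some `0 < θ' < θ < 1` and some real `A`, every abc triple
with `ω(abc) > (log rad(abc))^{θ'}` satisfies `c < rad(abc) · exp(A (log rad(abc))^θ)`.  Conjecture-grade. -/
theorem stub_ultraCompositeTail : ∃ θ' θ : ℝ, 0 < θ' ∧ θ' < θ ∧ θ < 1 ∧ ∃ A : ℝ, ∀ a b c : ℕ,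
    Literature.NumberTheory.DiophantineGeometry.IsABCTriple a b c →
    Real.log ((Literature.NumberTheory.DiophantineGeometry.rad a b c : ℕ) : ℝ) ^ θ'
        < ((ArithmeticFunction.cardDistinctFactors (a * b * c) : ℕ) : ℝ) →
    (c : ℝ) < ((Literature.NumberTheory.DiophantineGeometry.rad a b c : ℕ) : ℝ)
        * Real.exp (A * Real.log ((Literature.NumberTheory.DiophantineGeometry.rad a b c : ℕ) : ℝ) ^ θ) := by
  sorry

/-- GLUE + COMPOSITION: the crux `Target` by name, from exactly the two stubs, through the tree theorem
`Summit.ABC.ABC.Theorems.Target.target_of_bakerShape_of_tail : stub₁-statement → stub₂-statement → Target`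
(Theorems/FeketeScalesTargetOmegaSplit.lean, p96211).  The only sorries in its cone are the two stubs. -/
theorem Target_of : Summit.ABC.ABC.Theses.FeketeScales.Target :=
  Summit.ABC.ABC.Theorems.Target.target_of_bakerShape_of_tail stub_bakerRefinement stub_ultraCompositeTail

end Summit.ABC.ABC.Cruxes.Target.SketchIdeator2
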